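import Summits.HubbardSuperconductivity.HubbardSuperconductivity.Theorems.BalabanIRBirEveryGroundStateTwoScale

/-!
# Route `BalabanIR`, crux 5 `BirEveryGroundState` (`stmt-HubbardSuperconductivity-2083`):
# the two-scale TRANSFER on Hubbard tori (card `two-scale-domination`, Hubbard side)

Theses-free companion of `BalabanIRBirEveryGroundStateTwoScale.lean` (rev-5 MATERIALISATION
RULE: no route file is imported, directly or transitively). It instantiates the two-scale
domination inequality (★) on the objects of the crux: the sector ground projection `P` of
`hubbardTorus 2 L 1 U` at filling `2⌊(1-δ)L²/2⌋`, `S^z = 0`, and BLOCK pair fields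
`m_Λ(x) = Λ⁻² Σ_{v ∈ [0,Λ)²} P_{x+v}` (box averages of Scalapino's local `d_{x²-y²}` pair operator
`localPair dWaveFormFactor L`), whose anchor mean is exactly `Δ_d / L²`:

* `mul_le_re_of_twoScale` — the budgeted (★) with the normalisations as parameters (so that the
  Hubbard instantiation is literal).
* `sum_blockPair_eq_pairField` — the ANCHOR-MEAN identity `Σ_x m_Λ(x) = Δ_g` (`Λ ≥ 1`; each site
  lies in `Λ²` anchored boxes; translation invariance of the torus sum), for any form factor `g`.
* `forall_groundState_bound_of_twoScale` — ONE side, ONE block scale: if at `(U, δ, L, Λ)` the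
  GS-average has global intensity `Y_L = re tr (P Δ_d†Δ_d) / (L⁴ re tr P) ≥ c`, degeneracy
  `re tr P ≤ D`, block variance `V_{Λ,L} ≤ ε₁` and sag `A_{Λ,L} - Y_L ≤ ε₂` with
  `√(D ε₁) + D ε₂ ≤ c / 2`, then EVERY normalised sector ground state has
  `(c/2) L⁴ ≤ re ⟨ψ, Δ_d† Δ_d ψ⟩` — the shape consumed by the socket
  `forall_hasLRO_iff_groundState_bound` / `birEveryGroundState_structural_of_transfer`.
* `twoScaleTransferAt` — the card's `TwoScaleTransferAt U δ c D` (Sketch, unfolded): the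
  window-average bound at `U` eventually in even `L` + BLOCK RIGIDITY + NO SAG + a DEGENERACY
  BUDGET ⇒ the eventual every-ground-state bound with constant `c / 2`.
* `birEveryGroundState_structural_of_twoScale` — the body of the item, verbatim, from the card's
  typed residual `TwoScaleResidual` (unfolded): at some coupling of every window carrying the
  average bound, rigidity + no-sag + a budget hold. NOT proved here — rigidity and no-sag are
  GS-average correlation inequalities asked of the route's engine, the budget is the one
  exact-spectral conjecture; this module only shows that they SUFFICE, closing the crux by a
  three-line Theses-free file once they are theorems.

Griffiths, Phys. Rev. 152 (1966) 240 (block vs global order); Scalapino, Phys. Rep. 250 (1995) 329,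
§2 (pair field); Lieb, PRL 62 (1989) 1201 (sectors). Folklore bookkeeping; no definition is
introduced (the card's `blockPair`, `blockIntensity`, `globalIntensity`, `blockVariance`,
`BlockRigidityAt`, `NoSagAt`, `DegeneracyBudgetAt` appear unfolded, as `let`s).
-/

noncomputable section

namespace Summit.HubbardSuperconductivity.HubbardSuperconductivity.Theorems

open Matrix Finset Filter
open Literature.Probability.LatticeModels Literature.MathematicalPhysics.QuantumLattice
open Literature.Barriers.HubbardSuperconductivity
open scoped ComplexOrder

section Abstract

variable {n : Type*} [Fintype n] [DecidableEq n]

/-- **Budgeted two-scale domination, parametrised normalisations.** `mul_sq_card_le_re_of_twoScale`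
with the block count `|ι| = Nr`, its square `Nr² = N2` and the block sum `Σ_x m x = S` taken as
parameters: `c ≤ Y`, `d ≤ D`, `V ≤ ε₁`, `A - Y ≤ ε₂`, `√(D ε₁) + D ε₂ ≤ c / 2` ⇒
`(c / 2) N2 ≤ re ⟨ψ, Sᴴ S ψ⟩`, where `A = Σ_x re tr (P (m x)ᴴ m x) / (Nr d)`,
`Y = re tr (P Sᴴ S) / (N2 d)`, `V = Σ_x re tr (P ((m x)ᴴ m x - A)²) / (Nr d)`. [folklore] -/
theorem mul_le_re_of_twoScale (ι : Type*) [Fintype ι] [Nonempty ι] (m : ι → Matrix n n ℂ)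
    (K : Submodule ℂ (n → ℂ)) (ψ : n → ℂ) (hψK : ψ ∈ K) (hψ : star ψ ⬝ᵥ ψ = 1)
    (c D ε₁ ε₂ : ℝ) (hε : Real.sqrt (D * ε₁) + D * ε₂ ≤ c / 2) (Nr N2 : ℝ)
    (hNr : (Fintype.card ι : ℝ) = Nr) (hN2 : Nr ^ 2 = N2) (S : Matrix n n ℂ)
    (hS : ∑ x, m x = S) :
    let P : Matrix n n ℂ := projMatrix (K.map
      ((WithLp.linearEquiv 2 ℂ (n → ℂ)).symm : (n → ℂ) →ₗ[ℂ] EuclideanSpace ℂ n))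
    let d : ℝ := P.trace.re
    let A : ℝ := (∑ x, (P * ((m x)ᴴ * m x)).trace.re) / (Nr * d)
    let Y : ℝ := (P * (Sᴴ * S)).trace.re / (N2 * d)
    let V : ℝ := (∑ x, (P * (((m x)ᴴ * m x - (A : ℂ) • 1) *
      ((m x)ᴴ * m x - (A : ℂ) • 1))).trace.re) / (Nr * d)
    c ≤ Y → d ≤ D → V ≤ ε₁ → A - Y ≤ ε₂ → c / 2 * N2 ≤ (star ψ ⬝ᵥ (Sᴴ * S) *ᵥ ψ).re := by
  subst hNr hN2 hS
  exact mul_sq_card_le_re_of_twoScale ι m K ψ hψK hψ c D ε₁ ε₂ hε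

end Abstract

section Hubbard

/-- **The anchor-mean identity.** For a block scale `Λ ≥ 1` and any form factor `g`, the sum over
anchors `x` of the box averages `Λ⁻² Σ_{v ∈ [0,Λ)²} P_{x+v}` of the local pair operators is the
full pair field `Δ_g = Σ_x P_x`: for each offset `v`, `x ↦ x + v` is a bijection of the torus, so
every site is counted `Λ²` times. (Card `two-scale-domination`, stub `stub_anchorMean`; with it the
mean block `M = L⁻² Σ_x m_Λ(x)` is `Δ_g / L²` and `Mᴴ M = L⁻⁴ Δ_g† Δ_g`, the crux's order
observable.) Scalapino, Phys. Rep. 250 (1995) 329, §2. [folklore] -/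
theorem sum_blockPair_eq_pairField (g : Site 2 → ℝ) (L Λ : ℕ) [NeZero L] (hΛ : Λ ≠ 0) :
    ∑ x : TorusSite 2 L, ((((Λ : ℂ)) ^ 2)⁻¹ • ∑ v : Fin Λ × Fin Λ,
      localPair g L (x + ![((v.1 : ℕ) : ZMod L), ((v.2 : ℕ) : ZMod L)])) = pairField g L := by
  rw [← Finset.smul_sum, Finset.sum_comm]
  have h : ∀ v : Fin Λ × Fin Λ, ∑ x : TorusSite 2 L,
      localPair g L (x + ![((v.1 : ℕ) : ZMod L), ((v.2 : ℕ) : ZMod L)]) = pairField g L :=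
    fun v => Fintype.sum_equiv (Equiv.addRight _) _ _ fun x => rfl
  rw [Finset.sum_congr rfl fun v _ => h v, Finset.sum_const, Finset.card_univ, Fintype.card_prod,
    Fintype.card_fin, ← Nat.cast_smul_eq_nsmul ℂ, smul_smul]
  have hΛ' : ((Λ : ℂ)) ^ 2 ≠ 0 := pow_ne_zero 2 (Nat.cast_ne_zero.mpr hΛ)
  rw [Nat.cast_mul, ← sq, inv_mul_cancel₀ hΛ', one_smul]

/-- **Every ground state from the two-scale data, one side.** At coupling `U`, doping `δ`, side
`L` and block scale `Λ ≥ 1`, let `P` be the projection onto the sector ground eigenspace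
`E₀ = szSector N_L 0 ⊓ ker (H - e₀)` of `H = hubbardTorus 2 L 1 U` (`N_L = 2⌊(1-δ)L²/2⌋`),
`d = re tr P`, `m x` the block pair fields at scale `Λ`, and (GS-average functionals)
`A = Σ_x re tr (P (m x)ᴴ m x) / (L² d)` (block intensity), `Y = re tr (P Δ_d† Δ_d) / (L⁴ d)`
(global intensity), `V = Σ_x re tr (P ((m x)ᴴ m x - A)²) / (L² d)` (block variance). If
`c ≤ Y`, `d ≤ D`, `V ≤ ε₁`, `A - Y ≤ ε₂` and `√(D ε₁) + D ε₂ ≤ c / 2`, then EVERY normalised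
ground state of that sector has `(c / 2) L⁴ ≤ re ⟨ψ, Δ_d† Δ_d ψ⟩`: (★) with the anchor-mean
identity `Σ_x m x = Δ_d`. No representation theory, no genericity: the degeneracy enters only
through the budget `D`. Card `two-scale-domination` (`TwoScaleDomination` ⇒ transfer);
Griffiths, Phys. Rev. 152 (1966) 240. [folklore] -/
theorem forall_groundState_bound_of_twoScale (U δ c D ε₁ ε₂ : ℝ) (L Λ : ℕ) [NeZero L]
    (hΛ : Λ ≠ 0) (hε : Real.sqrt (D * ε₁) + D * ε₂ ≤ c / 2)
    (h : let N : ℕ := 2 * ⌊(1 - δ) * (L : ℝ) ^ 2 / 2⌋₊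
      let H := hubbardTorus 2 L 1 U
      let S := szSector (Λ := FermionTorus 2 L) N 0
      let E₀ := S ⊓ Module.End.eigenspace (Matrix.toLin' H) ((H.minEnergyOn S : ℝ) : ℂ)
      let P := projMatrix (E₀.map (Fock.toEuclidean (ι := Orb (FermionTorus 2 L)) :
        Fock (Orb (FermionTorus 2 L)) →ₗ[ℂ] EuclideanSpace ℂ (Finset (Orb (FermionTorus 2 L)))))
      let d : ℝ := P.trace.re
      let m := fun x : TorusSite 2 L => (((Λ : ℂ)) ^ 2)⁻¹ • ∑ v : Fin Λ × Fin Λ,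
        localPair dWaveFormFactor L (x + ![((v.1 : ℕ) : ZMod L), ((v.2 : ℕ) : ZMod L)])
      let A : ℝ := (∑ x, (P * ((m x)ᴴ * m x)).trace.re) / ((L : ℝ) ^ 2 * d)
      let Y : ℝ := (P * ((pairField dWaveFormFactor L)ᴴ * pairField dWaveFormFactor L)).trace.re /
        ((L : ℝ) ^ 4 * d)
      let V : ℝ := (∑ x, (P * (((m x)ᴴ * m x - (A : ℂ) • 1) *
        ((m x)ᴴ * m x - (A : ℂ) • 1))).trace.re) / ((L : ℝ) ^ 2 * d)
      c ≤ Y ∧ d ≤ D ∧ V ≤ ε₁ ∧ A - Y ≤ ε₂)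
    (ψ : Fock (Orb (FermionTorus 2 L)))
    (hgs : IsGroundStateInSector (hubbardTorus 2 L 1 U) (2 * ⌊(1 - δ) * (L : ℝ) ^ 2 / 2⌋₊) 0 ψ)
    (hunit : star ψ ⬝ᵥ ψ = 1) :
    c / 2 * (L : ℝ) ^ 4 ≤
      (star ψ ⬝ᵥ ((pairField dWaveFormFactor L)ᴴ * pairField dWaveFormFactor L) *ᵥ ψ).re := by
  obtain ⟨hcY, hdD, hV, hAY⟩ := h
  set H := hubbardTorus 2 L 1 U with hH
  set S := szSector (Λ := FermionTorus 2 L) (2 * ⌊(1 - δ) * (L : ℝ) ^ 2 / 2⌋₊) 0 with hS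
  set E₀ := S ⊓ Module.End.eigenspace (Matrix.toLin' H) ((H.minEnergyOn S : ℝ) : ℂ) with hE₀
  have hψE : ψ ∈ E₀ := by
    refine Submodule.mem_inf.mpr ⟨hgs.1, ?_⟩
    rw [Module.End.mem_eigenspace_iff, Matrix.toLin'_apply]
    exact hgs.2.2
  have hcard : (Fintype.card (TorusSite 2 L) : ℝ) = (L : ℝ) ^ 2 := by
    rw [Fintype.card_pi, Finset.prod_const, ZMod.card, Finset.card_univ, Fintype.card_fin]
    push_cast
    rfl
  have hN2 : ((L : ℝ) ^ 2) ^ 2 = (L : ℝ) ^ 4 := by ring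
  exact mul_le_re_of_twoScale (TorusSite 2 L) _ E₀ ψ hψE hunit c D ε₁ ε₂ hε _ _ hcard hN2 _
    (sum_blockPair_eq_pairField dWaveFormFactor L Λ hΛ) hcY hdD hV hAY

/-- **The card's `TwoScaleTransferAt U δ c D`** (Sketch `Sketch_ideator1g2.lean`, unfolded): at
one coupling `U`, the window-average bound `c ≤ Y_L` eventually in even `L`, BLOCK RIGIDITY
(`V_{Λ,L} → 0`: `∀ ε > 0, ∃ Λ₀, ∀ Λ ≥ Λ₀, ∃ L₀, ∀` even `L ≥ L₀`, `V ≤ ε`), NO SAG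
(`A_{Λ,L} - Y_L → 0` in the same sense) and a DEGENERACY BUDGET (`re tr P ≤ D` eventually) imply
that EVERY normalised sector ground state has `(c / 2) L⁴ ≤ re ⟨ψ, Δ_d† Δ_d ψ⟩` eventually in even
`L` — exactly the shape consumed by `forall_hasLRO_iff_groundState_bound` /
`birEveryGroundState_structural_of_transfer`. (For `c ≤ 0` the conclusion is free, `Δ_d† Δ_d ≥ 0`;
for `c > 0` take `ε₁ = (c/4)² / D'`, `ε₂ = c / (4 D')`, `D' = max D 1`, one block scale `Λ` beyond
both thresholds, and `forall_groundState_bound_of_twoScale`.) [folklore] -/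
theorem twoScaleTransferAt (U δ c D : ℝ) (havg : ∃ L₀ : ℕ, ∀ (L : ℕ) [NeZero L], L₀ ≤ L → Even L → let N : ℕ := 2 * ⌊(1 - δ) * (L : ℝ) ^ 2 / 2⌋₊; let H := hubbardTorus 2 L 1 U; let S := szSector (Λ := FermionTorus 2 L) N 0; let E₀ := S ⊓ Module.End.eigenspace (Matrix.toLin' H) ((H.minEnergyOn S : ℝ) : ℂ); let P := projMatrix (E₀.map (Fock.toEuclidean (ι := Orb (FermionTorus 2 L)) : Fock (Orb (FermionTorus 2 L)) →ₗ[ℂ] EuclideanSpace ℂ (Finset (Orb (FermionTorus 2 L))))); let d : ℝ := P.trace.re; let Y : ℝ := (P * ((pairField dWaveFormFactor L)ᴴ * pairField dWaveFormFactor L)).trace.re / ((L : ℝ) ^ 4 * d); c ≤ Y) (hrig : ∀ ε > 0, ∃ Λ₀ : ℕ, ∀ Λ ≥ Λ₀, ∃ L₀ : ℕ, ∀ (L : ℕ) [NeZero L], L₀ ≤ L → Even L → let N : ℕ := 2 * ⌊(1 - δ) * (L : ℝ) ^ 2 / 2⌋₊; let H := hubbardTorus 2 L 1 U; let S := szSector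 (Λ := FermionTorus 2 L) N 0; let E₀ := S ⊓ Module.End.eigenspace (Matrix.toLin' H) ((H.minEnergyOn S : ℝ) : ℂ); let P := projMatrix (E₀.map (Fock.toEuclidean (ι := Orb (FermionTorus 2 L)) : Fock (Orb (FermionTorus 2 L)) →ₗ[ℂ] EuclideanSpace ℂ (Finset (Orb (FermionTorus 2 L))))); let d : ℝ := P.trace.re; let m := fun x : TorusSite 2 L => (((Λ : ℂ)) ^ 2)⁻¹ • ∑ v : Fin Λ × Fin Λ, localPair dWaveFormFactor L (x + ![((v.1 : ℕ) : ZMod L), ((v.2 : ℕ) : ZMod L)]); let A : ℝ := (∑ x, (P * ((m x)ᴴ * m x)).trace.re) / ((L : ℝ) ^ 2 * d); let V : ℝ := (∑ x, (P * (((m x)ᴴ * m x - (A : ℂ) • 1) * ((m x)ᴴ * m x - (A : ℂ) • 1))).trace.re) / ((L : ℝ) ^ 2 * d); V ≤ ε) (hsag : ∀ ε > 0, ∃ Λ₀ : ℕ, ∀ Λ ≥ Λ₀, ∃ L₀ : ℕ, ∀ (L : ℕ) [NeZero L], L₀ ≤ L → Even L → let N : ℕ := 2 * ⌊(1 - δ)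 * (L : ℝ) ^ 2 / 2⌋₊; let H := hubbardTorus 2 L 1 U; let S := szSector (Λ := FermionTorus 2 L) N 0; let E₀ := S ⊓ Module.End.eigenspace (Matrix.toLin' H) ((H.minEnergyOn S : ℝ) : ℂ); let P := projMatrix (E₀.map (Fock.toEuclidean (ι := Orb (FermionTorus 2 L)) : Fock (Orb (FermionTorus 2 L)) →ₗ[ℂ] EuclideanSpace ℂ (Finset (Orb (FermionTorus 2 L))))); let d : ℝ := P.trace.re; let m := fun x : TorusSite 2 L => (((Λ : ℂ)) ^ 2)⁻¹ • ∑ v : Fin Λ × Fin Λ, localPair dWaveFormFactor L (x + ![((v.1 : ℕ) : ZMod L), ((v.2 : ℕ) : ZMod L)]); let A : ℝ := (∑ x, (P * ((m x)ᴴ * m x)).trace.re) / ((L : ℝ) ^ 2 * d); let Y : ℝ := (P * ((pairField dWaveFormFactor L)ᴴ * pairField dWaveFormFactor L)).trace.re / ((L : ℝ) ^ 4 * d); A - Y ≤ ε) (hbud : ∃ L₀ : ℕ, ∀ (L : ℕ) [NeZero L], L₀ ≤ L → Even L → let N : ℕ := 2 * ⌊(1 - δ) * (L : ℝ) ^ 2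 / 2⌋₊; let H := hubbardTorus 2 L 1 U; let S := szSector (Λ := FermionTorus 2 L) N 0; let E₀ := S ⊓ Module.End.eigenspace (Matrix.toLin' H) ((H.minEnergyOn S : ℝ) : ℂ); let P := projMatrix (E₀.map (Fock.toEuclidean (ι := Orb (FermionTorus 2 L)) : Fock (Orb (FermionTorus 2 L)) →ₗ[ℂ] EuclideanSpace ℂ (Finset (Orb (FermionTorus 2 L))))); let d : ℝ := P.trace.re; d ≤ D) : ∃ L₀ : ℕ, ∀ (L : ℕ) [NeZero L], L₀ ≤ L → Even L → ∀ ψ : Fock (Orb (FermionTorus 2 L)), IsGroundStateInSector (hubbardTorus 2 L 1 U) (2 * ⌊(1 - δ) * (L : ℝ) ^ 2 / 2⌋₊) 0 ψ → star ψ ⬝ᵥ ψ = 1 → c / 2 * (L : ℝ) ^ 4 ≤ (star ψ ⬝ᵥ ((pairField dWaveFormFactor L)ᴴ * pairField dWaveFormFactor L) *ᵥ ψ).re := by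
  by_cases hc : c ≤ 0
  · refine ⟨0, fun L _ _ _ ψ _ _ => ?_⟩
    have h0 := re_star_dotProduct_conjTranspose_mul_self_mulVec_nonneg (pairField dWaveFormFactor L) ψ
    have : c / 2 * (L : ℝ) ^ 4 ≤ 0 :=
      mul_nonpos_of_nonpos_of_nonneg (by linarith) (by positivity)
    exact this.trans h0
  replace hc : 0 < c := not_le.mp hc
  -- smallness parameters
  set D' : ℝ := max D 1 with hD'
  have hD'pos : 0 < D' := lt_of_lt_of_le one_pos (le_max_right _ _)
  have hDD' : D ≤ D' := le_max_left _ _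
  set ε₁ : ℝ := (c / 4) ^ 2 / D' with hε₁
  set ε₂ : ℝ := c / (4 * D') with hε₂
  have hε₁pos : 0 < ε₁ := by positivity
  have hε₂pos : 0 < ε₂ := by positivity
  have hε : Real.sqrt (D * ε₁) + D * ε₂ ≤ c / 2 := by
    have h1 : Real.sqrt (D * ε₁) ≤ c / 4 := by
      have : D * ε₁ ≤ (c / 4) ^ 2 := by
        calc D * ε₁ ≤ D' * ε₁ := mul_le_mul_of_nonneg_right hDD' hε₁pos.le
          _ = (c / 4) ^ 2 := by rw [hε₁]; field_simp
      calc Real.sqrt (D * ε₁) ≤ Real.sqrt ((c / 4) ^ 2) := Real.sqrt_le_sqrt this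
        _ = c / 4 := Real.sqrt_sq (by positivity)
    have h2 : D * ε₂ ≤ c / 4 := by
      calc D * ε₂ ≤ D' * ε₂ := mul_le_mul_of_nonneg_right hDD' hε₂pos.le
        _ = c / 4 := by rw [hε₂]; field_simp
    linarith
  -- thresholds
  obtain ⟨Λ₁, hΛ₁⟩ := hrig ε₁ hε₁pos
  obtain ⟨Λ₂, hΛ₂⟩ := hsag ε₂ hε₂pos
  set Λ : ℕ := max (max Λ₁ Λ₂) 1 with hΛdef
  have hΛ0 : Λ ≠ 0 := Nat.pos_iff_ne_zero.mp (lt_of_lt_of_le Nat.one_pos (le_max_right _ _))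
  obtain ⟨L₁, hL₁⟩ := hΛ₁ Λ ((le_max_left _ _).trans (le_max_left _ _))
  obtain ⟨L₂, hL₂⟩ := hΛ₂ Λ ((le_max_right _ _).trans (le_max_left _ _))
  obtain ⟨L₃, hL₃⟩ := havg
  obtain ⟨L₄, hL₄⟩ := hbud
  refine ⟨max (max L₁ L₂) (max L₃ L₄), fun L _ hL hLe ψ hgs hunit => ?_⟩
  have h1 := hL₁ L ((le_max_left _ _).trans ((le_max_left _ _).trans hL)) hLe
  have h2 := hL₂ L ((le_max_right _ _).trans ((le_max_left _ _).trans hL)) hLe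
  have h3 := hL₃ L ((le_max_left _ _).trans ((le_max_right _ _).trans hL)) hLe
  have h4 := hL₄ L ((le_max_right _ _).trans ((le_max_right _ _).trans hL)) hLe
  exact forall_groundState_bound_of_twoScale U δ c D ε₁ ε₂ L Λ hΛ0 hε ⟨h3, h4, h1, h2⟩ ψ hgs hunit

/-- **CLOSER ⇐ the two-scale residual** (card `two-scale-domination`, `TwoScaleResidual`
unfolded; Theses-free). Suppose that for all data `(δ, U₁, U₂, c)` the window-average hypothesis
of the crux (in the route's form `c L⁴ re tr P ≤ re tr (P Δ_d† Δ_d)`, eventually in even `L`, at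
every `U` of the window) yields ONE coupling `U` of the window and a budget `D` with BLOCK
RIGIDITY, NO SAG and `re tr P ≤ D` eventually (the RESIDUAL of the line — rigidity and no-sag are
GS-average correlation inequalities asked of the route's engine, the budget is an exact-spectral
conjecture; NOT proved). Then the body of `Theses.BalabanIR.BirEveryGroundState` holds: the
route's average form gives `c ≤ Y_L` (the sector is never empty, so `re tr P ≥ 1`),
`twoScaleTransferAt` gives the eventual every-ground-state bound with constant `c / 2`, and the
socket `birEveryGroundState_structural_of_transfer` concludes. [folklore] -/
theorem birEveryGroundState_structural_of_twoScale
    (hres : ∀ (δ U₁ U₂ c : ℝ), δ ∈ Set.Ioo (0:ℝ) (1/2) → 0 < U₁ → U₁ < U₂ → 0 < c →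
      (∀ U ∈ Set.Ioo U₁ U₂, ∃ L₀ : ℕ, ∀ (L : ℕ) [NeZero L], L₀ ≤ L → Even L →
        let N : ℕ := 2 * ⌊(1 - δ) * (L : ℝ) ^ 2 / 2⌋₊
        let H := hubbardTorus 2 L 1 U
        let S := szSector (Λ := FermionTorus 2 L) N 0
        let E₀ := S ⊓ Module.End.eigenspace (Matrix.toLin' H) ((H.minEnergyOn S : ℝ) : ℂ)
        let P := projMatrix (E₀.map (Fock.toEuclidean (ι := Orb (FermionTorus 2 L)) :
          Fock (Orb (FermionTorus 2 L)) →ₗ[ℂ] EuclideanSpace ℂ (Finset (Orb (FermionTorus 2 L)))))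
        c * (L : ℝ) ^ 4 * P.trace.re ≤
          (P * ((pairField dWaveFormFactor L)ᴴ * pairField dWaveFormFactor L)).trace.re) →
      ∃ U ∈ Set.Ioo U₁ U₂, ∃ D : ℝ,
        (∀ ε > 0, ∃ Λ₀ : ℕ, ∀ Λ ≥ Λ₀, ∃ L₀ : ℕ, ∀ (L : ℕ) [NeZero L], L₀ ≤ L → Even L →
          let N : ℕ := 2 * ⌊(1 - δ) * (L : ℝ) ^ 2 / 2⌋₊
          let H := hubbardTorus 2 L 1 U
          let S := szSector (Λ := FermionTorus 2 L) N 0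
          let E₀ := S ⊓ Module.End.eigenspace (Matrix.toLin' H) ((H.minEnergyOn S : ℝ) : ℂ)
          let P := projMatrix (E₀.map (Fock.toEuclidean (ι := Orb (FermionTorus 2 L)) :
            Fock (Orb (FermionTorus 2 L)) →ₗ[ℂ] EuclideanSpace ℂ (Finset (Orb (FermionTorus 2 L)))))
          let d : ℝ := P.trace.re
          let m := fun x : TorusSite 2 L => (((Λ : ℂ)) ^ 2)⁻¹ • ∑ v : Fin Λ × Fin Λ,
            localPair dWaveFormFactor L (x + ![((v.1 : ℕ) : ZMod L), ((v.2 : ℕ) : ZMod L)])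
          let A : ℝ := (∑ x, (P * ((m x)ᴴ * m x)).trace.re) / ((L : ℝ) ^ 2 * d)
          let V : ℝ := (∑ x, (P * (((m x)ᴴ * m x - (A : ℂ) • 1) *
            ((m x)ᴴ * m x - (A : ℂ) • 1))).trace.re) / ((L : ℝ) ^ 2 * d)
          V ≤ ε) ∧
        (∀ ε > 0, ∃ Λ₀ : ℕ, ∀ Λ ≥ Λ₀, ∃ L₀ : ℕ, ∀ (L : ℕ) [NeZero L], L₀ ≤ L → Even L →
          let N : ℕ := 2 * ⌊(1 - δ) * (L : ℝ) ^ 2 / 2⌋₊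
          let H := hubbardTorus 2 L 1 U
          let S := szSector (Λ := FermionTorus 2 L) N 0
          let E₀ := S ⊓ Module.End.eigenspace (Matrix.toLin' H) ((H.minEnergyOn S : ℝ) : ℂ)
          let P := projMatrix (E₀.map (Fock.toEuclidean (ι := Orb (FermionTorus 2 L)) :
            Fock (Orb (FermionTorus 2 L)) →ₗ[ℂ] EuclideanSpace ℂ (Finset (Orb (FermionTorus 2 L)))))
          let d : ℝ := P.trace.re
          let m := fun x : TorusSite 2 L => (((Λ : ℂ)) ^ 2)⁻¹ • ∑ v : Fin Λ × Fin Λ,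
            localPair dWaveFormFactor L (x + ![((v.1 : ℕ) : ZMod L), ((v.2 : ℕ) : ZMod L)])
          let A : ℝ := (∑ x, (P * ((m x)ᴴ * m x)).trace.re) / ((L : ℝ) ^ 2 * d)
          let Y : ℝ := (P * ((pairField dWaveFormFactor L)ᴴ * pairField dWaveFormFactor L)).trace.re /
            ((L : ℝ) ^ 4 * d)
          A - Y ≤ ε) ∧
        (∃ L₀ : ℕ, ∀ (L : ℕ) [NeZero L], L₀ ≤ L → Even L →
          let N : ℕ := 2 * ⌊(1 - δ) * (L : ℝ) ^ 2 / 2⌋₊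
          let H := hubbardTorus 2 L 1 U
          let S := szSector (Λ := FermionTorus 2 L) N 0
          let E₀ := S ⊓ Module.End.eigenspace (Matrix.toLin' H) ((H.minEnergyOn S : ℝ) : ℂ)
          let P := projMatrix (E₀.map (Fock.toEuclidean (ι := Orb (FermionTorus 2 L)) :
            Fock (Orb (FermionTorus 2 L)) →ₗ[ℂ] EuclideanSpace ℂ (Finset (Orb (FermionTorus 2 L)))))
          let d : ℝ := P.trace.re
          d ≤ D)) :
    ∀ (δ U₁ U₂ c : ℝ), δ ∈ Set.Ioo (0:ℝ) (1/2) → 0 < U₁ → U₁ < U₂ → 0 < c → (∀ U ∈ Set.Ioo U₁ U₂, ∃ L₀ : ℕ, ∀ (L : ℕ) [NeZero L], L₀ ≤ L → Even L → let N : ℕ := 2 * ⌊(1 - δ) * (L : ℝ) ^ 2 / 2⌋₊; let H := Literature.MathematicalPhysics.QuantumLattice.hubbardTorus 2 L 1 U; let S := Literature.MathematicalPhysics.QuantumLattice.szSector (Λ := Literature.MathematicalPhysics.QuantumLattice.FermionTorus 2 L) N 0; let E₀ := S ⊓ Module.End.eigenspace (Matrix.toLin' H) ((H.minEnergyOn S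 : ℝ) : ℂ); let P := Literature.MathematicalPhysics.QuantumLattice.projMatrix (E₀.map (Literature.MathematicalPhysics.QuantumLattice.Fock.toEuclidean (ι := Literature.MathematicalPhysics.QuantumLattice.Orb (Literature.MathematicalPhysics.QuantumLattice.FermionTorus 2 L)) : Literature.MathematicalPhysics.QuantumLattice.Fock (Literature.MathematicalPhysics.QuantumLattice.Orb (Literature.MathematicalPhysics.QuantumLattice.FermionTorus 2 L)) →ₗ[ℂ] EuclideanSpace ℂ (Finset (Literature.MathematicalPhysics.QuantumLattice.Orb (Literature.MathematicalPhysics.QuantumLattice.FermionTorus 2 L))))); c * (L : ℝ) ^ 4 * P.trace.re ≤ (P * (Matrix.conjTranspose (Literature.MathematicalPhysics.QuantumLattice.pairField Literature.MathematicalPhysics.QuantumLattice.dWaveFormFactor L) * Literature.MathematicalPhysics.QuantumLattice.pairField Literature.MathematicalPhysics.QuantumLattice.dWaveFormFactor L)).trace.re) → ∃ U ∈ Set.Ioo U₁ U₂, ∀ (N : ℕ → ℕ) (ψ : ∀ L, Literature.MathematicalPhysics.QuantumLattice.Fock (Literature.MathematicalPhysics.QuantumLattice.Orb (Literature.MathematicalPhysics.QuantumLattice.FermionTorus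 2 L))), (∀ L, Even L → N L = 2 * ⌊(1 - δ) * (L : ℝ) ^ 2 / 2⌋₊ ∧ star (ψ L) ⬝ᵥ ψ L = 1 ∧ Literature.MathematicalPhysics.QuantumLattice.IsGroundStateInSector (Literature.MathematicalPhysics.QuantumLattice.hubbardTorus 2 L 1 U) (N L) 0 (ψ L)) → Literature.Probability.LatticeModels.HasLongRangeOrder (fun k => Literature.Probability.LatticeModels.halfOpenBox 2 (2 * k)) (fun k => Literature.MathematicalPhysics.QuantumLattice.torusPullback (Literature.MathematicalPhysics.QuantumLattice.pairFieldCorr Literature.MathematicalPhysics.QuantumLattice.dWaveFormFactor ψ) (2 * k)) := by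
  refine birEveryGroundState_structural_of_transfer fun δ U₁ U₂ c hδ hU₁ hU₁₂ hc hyp => ?_
  obtain ⟨U, hU, D, hrig, hsag, hbud⟩ := hres δ U₁ U₂ c hδ hU₁ hU₁₂ hc hyp
  obtain ⟨L₀, hL₀⟩ := hyp U hU
  refine ⟨U, hU, c / 2, half_pos hc, twoScaleTransferAt U δ c D ⟨L₀, fun L _ hL hLe => ?_⟩
    hrig hsag hbud⟩
  -- the route's average form `c L⁴ re tr P ≤ re tr (P O)` gives `c ≤ Y_L` since `re tr P ≥ 1`
  have havg := hL₀ L hL hLe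
  intro N H S E₀ P d Y
  change c * (L : ℝ) ^ 4 * d ≤
    (P * ((pairField dWaveFormFactor L)ᴴ * pairField dWaveFormFactor L)).trace.re at havg
  -- a normalised sector ground state exists, so `E₀ ≠ ⊥` and `d = dim E₀ ≥ 1`
  obtain ⟨φ, hφ1, hφgs⟩ := exists_unit_isGroundStateInSector_hubbardTorus U L
    (⌊(1 - δ) * (L : ℝ) ^ 2 / 2⌋₊) (natFloor_filling_le_sq (δ := δ) (by linarith [hδ.1]) L)
  have hφE : φ ∈ E₀ := by
    refine Submodule.mem_inf.mpr ⟨hφgs.1, ?_⟩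
    rw [Module.End.mem_eigenspace_iff, Matrix.toLin'_apply]
    exact hφgs.2.2
  have hne : E₀ ≠ ⊥ := by
    refine (Submodule.ne_bot_iff _).mpr ⟨φ, hφE, ?_⟩
    rintro rfl
    simp at hφ1
  have hd : d = (Module.finrank ℂ E₀ : ℝ) := by
    show (projMatrix (E₀.map ((WithLp.linearEquiv 2 ℂ (Finset (Orb (FermionTorus 2 L)) → ℂ)).symm :
      (Finset (Orb (FermionTorus 2 L)) → ℂ) →ₗ[ℂ]
        EuclideanSpace ℂ (Finset (Orb (FermionTorus 2 L)))))).trace.re = _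
    rw [trace_projMatrix_map_eq_finrank, Complex.natCast_re]
  have hdpos : 0 < d := by
    rw [hd, Nat.cast_pos]
    exact Module.finrank_pos_iff.mpr (Submodule.nontrivial_iff_ne_bot.mpr hne)
  have hLpos : (0 : ℝ) < (L : ℝ) ^ 4 := by
    have : (0 : ℝ) < L := Nat.cast_pos.mpr (Nat.pos_of_ne_zero (NeZero.ne L))
    positivity
  show c ≤ (P * ((pairField dWaveFormFactor L)ᴴ * pairField dWaveFormFactor L)).trace.re /
    ((L : ℝ) ^ 4 * d)
  rw [le_div_iff₀ (mul_pos hLpos hdpos), ← mul_assoc]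
  exact havg

end Hubbard

end Summit.HubbardSuperconductivity.HubbardSuperconductivity.Theorems
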